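import Literature.Barriers.Parity.EuclideanProofs
import Mathlib.Analysis.Polynomial.Basic
import Mathlib.RingTheory.Localization.Integral
import Mathlib.Data.Nat.ChineseRemainder

/-!
# Pollack's Theorem 1 under Hypothesis H — proof of the named fact `Pollack2010_ePrime`

This file discharges the named fact `Literature.Barriers.Parity.Pollack2010_ePrime` of the
barrier catalogue entry `Literature/Barriers/Parity/EuclideanProofs.lean` (whose other two named
facts are discharged in the siblings `EuclideanProofsProofs.lean` — Murty's theorem
`EuclideanProofBarrier_holds` via Chebotarev for `K(ζ_m)/K` — and `EuclideanProofsSchurProofs.lean`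
— Schur's existence theorem): `theorem Pollack2010_ePrime_holds : Pollack2010_ePrime` — assuming
Schinzel's Hypothesis H (`Literature.NumberTheory.Sieve.SchinzelHypothesisH`), an `E′`-polynomial
for the progression `a mod m` (`IsEPrimePolynomial f a m`, `0 < m`) exists only if
`a² ≡ 1 (mod m)` [cite: Pollack2010MurtyH, Theorem 1].

## The printed proof (Pollack, §4) and what is formalised

* Lemma 4 (with Schinzel's Lemma 2): an `E′`-polynomial may be assumed free of fixed prime
  divisors. Lemma 5: it may be assumed to be a product `f = f₁ ⋯ f_k` of distinct irreducible
  non-constant polynomials with positive leading coefficients, constant `mod m`, with `f(0)`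
  coprime to `m`. Lemma 6 (H): for prime divisors `p_i ∥ f_i(n₀)` not dividing the other
  `f_j(n₀)`, the polynomials `f_i(PT + n₀)/p_i`, `P = (∏ p_i)²`, satisfy the hypotheses of H, so
  there are arbitrarily large `n` with `f_i(n) = p_i q_i`, `q_i` prime. Proof of Theorem 1: let `R`
  be the set of `i` with `f_i(0) ≡ a`; if no `f_i`, `i ∈ R`, were an `E`-polynomial, each would
  have a large prime divisor `p_i ∉ {1, a} (mod m)`, and Lemma 6 would give a value `f(n)` without
  prime factors `≡ a (mod m)` (`q_i ≡ a p_i⁻¹ ≢ a`, `q_j ≡ f_j(0) ≢ a`), contradicting (i). So some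
  `f_i` is an `E`-polynomial, and Murty's theorem gives `a² ≡ 1 (mod m)`.
  [cite: Pollack2010MurtyH, §4 (Lemmas 4–6 and proof of Theorem 1)]
* For the last step the printed proof invokes Murty's theorem. The tree proves it
  (`EuclideanProofBarrier_holds`, sibling file `EuclideanProofsProofs.lean`, from Chebotarev's
  density theorem for `K(ζ_m)/K`), but here — as in Pollack's §3, whose point is that under
  Bunyakovsky / H the impossibility theorem is elementary — the step is taken INSIDE H, by
  Lemma 3 with `k = 1`: given two prime divisors `p₀, p₁ ≡ a` of `f_i` dividing `f_i(r)` exactly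
  once, the polynomial `f_i(p₀p₁PT + r)/(p₀p₁)` takes a large prime value
  `q ≡ a · a⁻² = a⁻¹ (mod m)` dividing a value of `f_i` exactly once; hence `a⁻¹ ∈ {1, a}`, i.e.
  `a² ≡ 1`. This keeps the proof self-contained and elementary given H (Gauss's lemma, the Chinese
  remainder theorem and a Bezout identity are its only inputs) and is also the shorter road:
  feeding `EuclideanProofBarrier_holds` would need condition (3) for ALL prime divisors of the
  factor, i.e. the resultant step `p ∤ Res(f_i, f_i′)` of Lemma 6, whereas the H-internal route
  needs it only for primes with an exact-division witness, which H itself supplies.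
  [cite: Pollack2010MurtyH, §3 Lemma 3]
* Formal architecture (namespace `Literature.Barriers.Parity.Pollack2010`):
  `exists_prime_cofactors_of_hypothesisH` is Lemma 6, generalised to arbitrary unitary divisors
  `b_g ∥ g(n₀)` and to a base product WITH fixed prime divisors: these, the primes of `m` and the
  prescribed primes form a finite set `L`, the step `P` is supported on `L`, and the cofactors
  `g(n₀)/b_g` are coprime to `L`; a fixed prime divisor of `∏ g(PT+n₀)/b_g` divides
  `∏ g(n₀)/b_g`, so lies outside `L`, so does not divide `P`, so is a fixed prime divisor of
  `∏ g` — contradiction (this is why Lemmas 2 and 4 are not needed). `exists_family` and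
  `exists_prime_cofactors_in_family` run the H-step along the "controlled family"
  `n ≡ n⋆ (mod K)`, on which the `L₀`-part `B_g` of each `g(n)` and the class of `g(n)/B_g`
  `mod m` are constant (replacing the normalisations "`f(0)` coprime to `m`", "`f_i` constant
  `mod m`" of Lemma 5). `exists_factor_with_good_primes` is the contradiction in the proof of
  Theorem 1 (Stage A: some factor `g₀` with `g₀(n)/B_{g₀} ≡ a` has all its large exactly-dividing
  primes in `{1, a}`), and `sq_modEq_one_of_good_primes` is Lemma 3 with `k = 1` (Stage B).
  Exact-division witnesses `q ∥ g(n)` are supplied by H itself (a prime value `q > b` of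
  `g(PT+n₀)/b` divides `g(Pt+n₀) = bq` exactly once), so the resultant conditions (5) of Lemma 6
  are replaced by a Bezout bound (`exists_bound_common_prime`: two distinct factors have common
  prime divisors at the same argument only below a fixed bound). `reduce_squarefree` is the
  factorisation step of Lemma 5; `IsEPrimePolynomial.isUnit_cast` records `gcd(a, m) = 1`.

## References

* P. Pollack, *Hypothesis H and an impossibility theorem of Ram Murty*, Rend. Sem. Mat. Univ.
  Politec. Torino 68 (2010), 183–197, read on the page (pp. 188–193)
  [cite: Pollack2010MurtyH, §3 (Lemmas 2–3), §4 (Lemmas 4–6, proof of Theorem 1, Remark 1)].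

## Not here

Remark 1 (under H every `E′`-polynomial is divisible by an `E`-polynomial) and the unconditional
Problem of §5.2 are not formalised; the proof uses neither `EuclideanProofBarrier_holds` /
`PrimeDivisorClassesSubgroup_holds` (sibling `EuclideanProofsProofs.lean`) nor Schur's theorem
(sibling `EuclideanProofsSchurProofs.lean`).
-/

open Polynomial Filter

namespace Literature.Barriers.Parity

namespace Pollack2010

/-! #### Growth, congruences of values, `L`-parts -/

/-- An integer polynomial of positive degree with positive leading coefficient eventually exceeds
any bound (via `Polynomial.tendsto_atTop_of_leadingCoeff_nonneg` over `ℝ`). [folklore] -/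
theorem exists_forall_le_eval {g : ℤ[X]} (hdeg : 0 < g.natDegree) (hlc : 0 < g.leadingCoeff)
    (N : ℤ) : ∃ n₁ : ℤ, ∀ n : ℤ, n₁ ≤ n → N ≤ g.eval n := by
  set G : ℝ[X] := g.map (Int.castRingHom ℝ) with hG
  have hdeg' : 0 < G.degree := by
    rw [hG, degree_map_eq_of_injective Int.cast_injective]
    exact natDegree_pos_iff_degree_pos.mp hdeg
  have hlc' : 0 ≤ G.leadingCoeff := by
    rw [hG, leadingCoeff_map_of_injective Int.cast_injective, eq_intCast]
    exact_mod_cast hlc.le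
  have ht := (G.tendsto_atTop_of_leadingCoeff_nonneg hdeg' hlc').comp tendsto_intCast_atTop_atTop
  obtain ⟨n₁, hn₁⟩ := (tendsto_atTop_atTop.mp ht) (N : ℝ)
  refine ⟨n₁, fun n hn => ?_⟩
  have h := hn₁ n hn
  simp only [Function.comp_apply, hG, eval_intCast_map, eq_intCast] at h
  exact_mod_cast h

/-- Values of an integer polynomial at congruent arguments are congruent. [folklore] -/
theorem eval_modEq_of_modEq (g : ℤ[X]) {k x y : ℤ} (h : x ≡ y [ZMOD k]) :
    g.eval x ≡ g.eval y [ZMOD k] := by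
  rw [Int.modEq_iff_dvd] at h ⊢
  exact h.trans (sub_dvd_eval_sub y x g)

/-- The `L`-part of a non-zero integer: `x = b e` with `b > 0` supported on the finite set of
primes `L` and `e` coprime to `L`. [folklore] -/
theorem exists_lpart (L : Finset ℕ) (hL : ∀ ℓ ∈ L, ℓ.Prime) {x : ℤ} (hx : x ≠ 0) :
    ∃ (b : ℕ) (e : ℤ), 0 < b ∧ x = b * e ∧ (∀ ℓ ∈ L, ¬ (ℓ : ℤ) ∣ e) ∧
      ∀ p : ℕ, p.Prime → p ∣ b → p ∈ L := by
  classical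
  induction L using Finset.induction_on with
  | empty =>
    refine ⟨1, x, one_pos, by simp, by simp, fun p hp h => ?_⟩
    exact absurd (Nat.le_of_dvd one_pos h) (not_le.mpr hp.one_lt)
  | insert ℓ L hℓ ih =>
    obtain ⟨b, e, hb, hxe, hcop, hprimes⟩ := ih fun l hl => hL l (Finset.mem_insert_of_mem hl)
    have hℓp : ℓ.Prime := hL ℓ (Finset.mem_insert_self ℓ L)
    have he0 : e ≠ 0 := by
      rintro rfl
      simp at hxe
      exact hx hxe
    obtain ⟨k, c, hc, hkc⟩ :=
      Nat.exists_eq_pow_mul_and_not_dvd (Int.natAbs_ne_zero.mpr he0) ℓ hℓp.ne_one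
    have hkc' : (e.natAbs : ℤ) = (ℓ : ℤ) ^ k * c := by exact_mod_cast hkc
    refine ⟨b * ℓ ^ k, e.sign * c, mul_pos hb (pow_pos hℓp.pos k), ?_, ?_, ?_⟩
    · calc x = b * e := hxe
        _ = b * (e.sign * (e.natAbs : ℤ)) := by rw [Int.sign_mul_natAbs]
        _ = _ := by rw [hkc']; push_cast; ring
    · intro l hl
      rcases Finset.mem_insert.mp hl with rfl | hl
      · intro hd
        apply hc
        have h1 := Int.natAbs_dvd_natAbs.mpr hd
        rwa [Int.natAbs_mul, Int.natAbs_sign_of_ne_zero he0, one_mul, Int.natAbs_natCast,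
          Int.natAbs_natCast] at h1
      · intro hd
        apply hcop l hl
        have : e.sign * (c : ℤ) ∣ e := by
          refine ⟨(ℓ : ℤ) ^ k, ?_⟩
          calc e = e.sign * (e.natAbs : ℤ) := (Int.sign_mul_natAbs e).symm
            _ = _ := by rw [hkc']; ring
        exact hd.trans this
    · intro p hp hpd
      rcases (Nat.Prime.dvd_mul hp).mp hpd with h | h
      · exact Finset.mem_insert_of_mem (hprimes p hp h)
      · have := (Nat.prime_dvd_prime_iff_eq hp hℓp).mp (hp.dvd_of_dvd_pow h)
        subst this
        exact Finset.mem_insert_self _ _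

/-! #### A Bezout-type bound -/

/-- Two non-associated irreducible integer polynomials (the first non-constant) have a common
prime divisor at the same argument only below a fixed bound: `A g + B g' = ρ ≠ 0` in `ℤ[X]`
(coprimality in `ℚ[X]` plus clearing denominators). [folklore] -/
theorem exists_bound_common_prime {g g' : ℤ[X]} (hg : Irreducible g) (hg' : Irreducible g')
    (hdeg : 0 < g.natDegree) (hne : ¬Associated g g') :
    ∃ ρ : ℕ, ∀ p : ℕ, p.Prime → ∀ n : ℤ, (p : ℤ) ∣ g.eval n → (p : ℤ) ∣ g'.eval n → p ≤ ρ := by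
  have hprim : g.IsPrimitive := hg.isPrimitive hdeg.ne'
  have hgQ : Irreducible (g.map (Int.castRingHom ℚ)) :=
    (IsPrimitive.Int.irreducible_iff_irreducible_map_cast hprim).mp hg
  have hndvd : ¬g.map (Int.castRingHom ℚ) ∣ g'.map (Int.castRingHom ℚ) := fun h =>
    hne (hg.associated_of_dvd hg'
      ((IsPrimitive.Int.dvd_iff_map_cast_dvd_map_cast g g' hprim).mpr h))
  obtain ⟨A, B, hAB⟩ := hgQ.coprime_iff_not_dvd.mpr hndvd
  obtain ⟨b₁, hb₁, hA⟩ := IsLocalization.integerNormalization_spec (nonZeroDivisors ℤ) A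
  obtain ⟨b₂, hb₂, hB⟩ := IsLocalization.integerNormalization_spec (nonZeroDivisors ℤ) B
  set A₀ := IsLocalization.integerNormalization (nonZeroDivisors ℤ) A with hA₀
  set B₀ := IsLocalization.integerNormalization (nonZeroDivisors ℤ) B with hB₀
  rw [algebraMap_int_eq, ← Int.cast_smul_eq_zsmul ℚ, smul_eq_C_mul] at hA hB
  have hb₁0 : b₁ ≠ 0 := nonZeroDivisors.ne_zero hb₁
  have hb₂0 : b₂ ≠ 0 := nonZeroDivisors.ne_zero hb₂
  have hid : C b₂ * A₀ * g + C b₁ * B₀ * g' = C b₁ * C b₂ := by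
    apply map_injective (Int.castRingHom ℚ) (RingHom.injective_int _)
    simp only [Polynomial.map_add, Polynomial.map_mul, map_C, Int.coe_castRingHom, hA, hB]
    linear_combination (C (b₁ : ℚ) * C (b₂ : ℚ)) * hAB
  refine ⟨(b₁ * b₂).natAbs, fun p hp n hpg hpg' => ?_⟩
  have h := congr_arg (eval n) hid
  simp only [eval_add, eval_mul, eval_C] at h
  have hdvd : (p : ℤ) ∣ b₁ * b₂ := by
    rw [← h]
    exact dvd_add (dvd_mul_of_dvd_right hpg _) (dvd_mul_of_dvd_right hpg' _)
  have := Int.natAbs_dvd_natAbs.mpr hdvd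
  rw [Int.natAbs_natCast] at this
  exact Nat.le_of_dvd (Int.natAbs_pos.mpr (mul_ne_zero hb₁0 hb₂0)) this

/-! #### The H-step (Pollack's Lemma 6, generalised) -/

/-- The auxiliary polynomial of the H-step is
`G = C e + (divX (taylor n₀ g)).comp (C P * X) * (C (P / b) * X)` (for `g.eval n₀ = b * e` and
`b ∣ P`) — Pollack's `g_i(T) = f_i(PT + n₀)/p_i`; this is its defining identity
`C b * G = g.comp (C P * X + C n₀)`. [cite: Pollack2010MurtyH, §4 Lemma 6 (proof)] -/
private theorem C_mul_hpoly (g : ℤ[X]) (n₀ : ℤ) {P b : ℕ} {e : ℤ} (hbP : b ∣ P) (hb : 0 < b)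
    (hge : g.eval n₀ = b * e) :
    C (b : ℤ) * (C e + (divX (taylor n₀ g)).comp (C (P : ℤ) * X) * (C ((P / b : ℕ) : ℤ) * X)) =
      g.comp (C (P : ℤ) * X + C n₀) := by
  obtain ⟨P', hP'⟩ := hbP
  have hdiv : P / b = P' := by rw [hP', Nat.mul_div_cancel_left _ hb]
  rw [hdiv]
  have h1 : g.comp (C (P : ℤ) * X + C n₀) = (taylor n₀ g).comp (C (P : ℤ) * X) := by
    rw [taylor_apply, comp_assoc]
    congr 1
    simp only [add_comp, X_comp, C_comp]
  rw [h1]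
  conv_rhs => rw [← divX_mul_X_add (taylor n₀ g)]
  rw [taylor_coeff_zero, hge, add_comp, mul_comp, X_comp, C_comp, hP']
  push_cast
  simp only [C_mul]
  ring

/-- Values of the auxiliary polynomial: `b G(t) = g(Pt + n₀)`. [folklore] -/
private theorem hpoly_eval_mul (g : ℤ[X]) (n₀ : ℤ) {P b : ℕ} {e : ℤ} (hbP : b ∣ P) (hb : 0 < b)
    (hge : g.eval n₀ = b * e) (t : ℤ) :
    (b : ℤ) * (C e + (divX (taylor n₀ g)).comp (C (P : ℤ) * X) * (C ((P / b : ℕ) : ℤ) * X)).eval t =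
      g.eval (P * t + n₀) := by
  have := congr_arg (eval t) (C_mul_hpoly g n₀ hbP hb hge)
  simpa [eval_comp] using this

/-- The auxiliary polynomial at `0`: `G(0) = e`. [folklore] -/
private theorem hpoly_eval_zero (g : ℤ[X]) (n₀ : ℤ) (P b : ℕ) (e : ℤ) :
    (C e + (divX (taylor n₀ g)).comp (C (P : ℤ) * X) * (C ((P / b : ℕ) : ℤ) * X)).eval 0 = e := by
  simp

/-- The auxiliary polynomial is `≡ e (mod P / b)` at every integer. [folklore] -/
private theorem hpoly_eval_modEq (g : ℤ[X]) (n₀ : ℤ) (P b : ℕ) (e : ℤ) (t : ℤ) :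
    (C e + (divX (taylor n₀ g)).comp (C (P : ℤ) * X) * (C ((P / b : ℕ) : ℤ) * X)).eval t ≡ e
      [ZMOD ((P / b : ℕ) : ℤ)] := by
  simp only [eval_add, eval_C, eval_mul, eval_X, eval_comp]
  rw [Int.modEq_iff_dvd]
  exact ⟨-(((taylor n₀) g).divX.eval (↑P * t) * t), by ring⟩

/-- **The H-step** (Pollack's Lemma 6, generalised to arbitrary divisors `b_g` of `g(n₀)` and to
a base product with fixed prime divisors, which are absorbed into the step `P`): assuming
Hypothesis H, for irreducible non-constant `g ∈ s` with positive leading coefficients, a base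
point `n₀`, a positive step `P` with `b_g ∣ P`, and factorizations `g(n₀) = b_g e_g` with every
`e_g` coprime to a finite set of primes `L` containing the fixed prime divisors of `∏ g` and the
primes of `P`, the polynomials `g(P T + n₀)/b_g` satisfy the hypotheses of H (a fixed prime
divisor would divide `∏ e_g`, so lie outside `L`, so be prime to `P`, so be a fixed prime divisor
of `∏ g`), hence there are arbitrarily large `t` with every `g(P t + n₀) = b_g q_g`, `q_g` prime,
`q_g ≡ e_g (mod P / b_g)`. [cite: Pollack2010MurtyH, §4 Lemma 6 (proof)] -/
theorem exists_prime_cofactors_of_hypothesisH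
    (hH : Literature.NumberTheory.Sieve.SchinzelHypothesisH)
    {s : Finset ℤ[X]} (hs : ∀ g ∈ s, Irreducible g ∧ 0 < g.natDegree ∧ 0 < g.leadingCoeff)
    (n₀ : ℤ) {L : Finset ℕ}
    (hfix : ∀ p : ℕ, p.Prime → (∀ n : ℤ, (p : ℤ) ∣ ∏ g ∈ s, g.eval n) → p ∈ L)
    {b : ℤ[X] → ℕ} {e : ℤ[X] → ℤ} (hb : ∀ g ∈ s, 0 < b g)
    (hbe : ∀ g ∈ s, g.eval n₀ = b g * e g)
    (hcop : ∀ g ∈ s, ∀ ℓ ∈ L, ¬(ℓ : ℤ) ∣ e g)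
    {P : ℕ} (hP : 0 < P) (hPL : ∀ p : ℕ, p.Prime → p ∣ P → p ∈ L)
    (hbP : ∀ g ∈ s, b g ∣ P) :
    ∀ N : ℤ, ∃ t : ℤ, N ≤ t ∧ ∀ g ∈ s, ∃ q : ℤ, Prime q ∧
      g.eval (P * t + n₀) = b g * q ∧ q ≡ e g [ZMOD ((P / b g : ℕ) : ℤ)] := by
  classical
  intro N
  set G : ℤ[X] → ℤ[X] := fun g =>
    C (e g) + (divX (taylor n₀ g)).comp (C (P : ℤ) * X) * (C ((P / b g : ℕ) : ℤ) * X) with hGdef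
  have hCG : ∀ g ∈ s, C (b g : ℤ) * G g = g.comp (C (P : ℤ) * X + C n₀) := fun g hg =>
    C_mul_hpoly g n₀ (hbP g hg) (hb g hg) (hbe g hg)
  have hP0 : ((P : ℤ)) ≠ 0 := by exact_mod_cast hP.ne'
  have hlin : (C (P : ℤ) * X + C n₀).natDegree = 1 := natDegree_linear hP0
  have hdegG : ∀ g ∈ s, (G g).natDegree = g.natDegree := by
    intro g hg
    have hb0 : (b g : ℤ) ≠ 0 := by exact_mod_cast (hb g hg).ne'
    have := congr_arg natDegree (hCG g hg)
    rwa [natDegree_C_mul hb0, natDegree_comp, hlin, mul_one] at this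
  have hG0 : ∀ g ∈ s, G g ≠ 0 := by
    intro g hg h0
    have := hdegG g hg
    rw [h0, natDegree_zero] at this
    exact (hs g hg).2.1.ne' this.symm
  -- evaluation identities
  have hGeval : ∀ g ∈ s, ∀ t : ℤ, g.eval (P * t + n₀) = b g * (G g).eval t := fun g hg t =>
    (hpoly_eval_mul g n₀ (hbP g hg) (hb g hg) (hbe g hg) t).symm
  -- no fixed prime divisor of `∏ G`
  have hnofix : ∀ p : ℕ, p.Prime → ¬∀ t : ℤ, (p : ℤ) ∣ ∏ g ∈ s, (G g).eval t := by
    intro p hp hall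
    have hpZ : Prime (p : ℤ) := Nat.prime_iff_prime_int.mp hp
    have h0 : (p : ℤ) ∣ ∏ g ∈ s, e g := by
      have := hall 0
      rwa [Finset.prod_congr rfl fun g _ => hpoly_eval_zero g n₀ P (b g) (e g)] at this
    obtain ⟨g₁, hg₁, hpg₁⟩ := hpZ.exists_mem_finset_dvd h0
    have hpL : p ∉ L := fun h => hcop g₁ hg₁ p h hpg₁
    have hpP : ¬p ∣ P := fun h => hpL (hPL p hp h)
    apply hpL (hfix p hp ?_)
    intro n
    have hcopr : IsCoprime (P : ℤ) (p : ℤ) :=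
      Nat.isCoprime_iff_coprime.mpr ((Nat.Prime.coprime_iff_not_dvd hp).mpr hpP).symm
    obtain ⟨u, v, huv⟩ := hcopr
    set t := u * (n - n₀) with ht
    have hmod : ∀ g ∈ s, g.eval n % p = g.eval ((P : ℤ) * t + n₀) % p := by
      intro g _
      apply eval_modEq_of_modEq
      rw [Int.modEq_iff_dvd]
      exact ⟨-(v * (n - n₀)), by linear_combination (n - n₀) * huv⟩
    have h2 : (p : ℤ) ∣ ∏ g ∈ s, g.eval ((P : ℤ) * t + n₀) := by
      rw [Finset.prod_congr rfl fun g hg => hGeval g hg t, Finset.prod_mul_distrib]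
      exact dvd_mul_of_dvd_right (hall t) _
    rw [Int.dvd_iff_emod_eq_zero, Finset.prod_int_mod, Finset.prod_congr rfl hmod,
      ← Finset.prod_int_mod, ← Int.dvd_iff_emod_eq_zero]
    exact h2
  -- the finset fed to Hypothesis H
  set S := s.image G with hS
  have hS1 : ∀ G' ∈ S, Irreducible G' ∧ 1 ≤ G'.natDegree ∧ 0 < G'.leadingCoeff := by
    intro G' hG'
    obtain ⟨g, hg, rfl⟩ := Finset.mem_image.mp hG'
    obtain ⟨hgirr, hgdeg, hglc⟩ := hs g hg
    have hid := hCG g hg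
    have hb0 : (b g : ℤ) ≠ 0 := by exact_mod_cast (hb g hg).ne'
    have hlcG : (b g : ℤ) * (G g).leadingCoeff = g.leadingCoeff * (P : ℤ) ^ g.natDegree := by
      have := congr_arg leadingCoeff hid
      rwa [leadingCoeff_mul, leadingCoeff_C, leadingCoeff_comp (by rw [hlin]; exact one_ne_zero),
        leadingCoeff_linear hP0] at this
    refine ⟨?_, by rw [hdegG g hg]; exact hgdeg, ?_⟩
    · have hprimG : (G g).IsPrimitive := by
        rw [isPrimitive_iff_isUnit_of_C_dvd]
        intro r hr
        by_contra hru
        have hr0 : r ≠ 0 := by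
          rintro rfl
          rw [C_0, zero_dvd_iff] at hr
          exact hG0 g hg hr
        obtain ⟨p, hp, hpr⟩ :=
          Nat.exists_prime_and_dvd (n := r.natAbs) (by rwa [Ne, ← Int.isUnit_iff_natAbs_eq])
        apply hnofix p hp
        intro t
        have h1 : (p : ℤ) ∣ r := Int.natCast_dvd.mpr hpr
        have h2 : (p : ℤ) ∣ (G g).eval t := by
          obtain ⟨H, hH'⟩ := hr
          rw [hH', eval_mul, eval_C]
          exact dvd_mul_of_dvd_left h1 _
        exact h2.trans (Finset.dvd_prod_of_mem (fun g' => (G g').eval t) hg)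
      have hirrQ : Irreducible ((G g).map (Int.castRingHom ℚ)) := by
        have hgQ : Irreducible (g.map (Int.castRingHom ℚ)) :=
          (IsPrimitive.Int.irreducible_iff_irreducible_map_cast (hgirr.isPrimitive hgdeg.ne')).mp
            hgirr
        have hidQ := congr_arg (Polynomial.map (Int.castRingHom ℚ)) hid
        simp only [Polynomial.map_mul, map_C, Int.coe_castRingHom, Polynomial.map_comp,
          Polynomial.map_add, map_X] at hidQ
        haveI : Invertible ((P : ℤ) : ℚ) := invertibleOfNonzero (by exact_mod_cast hP0)
        have hcomp : Irreducible ((g.map (Int.castRingHom ℚ)).comp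
            (C ((P : ℤ) : ℚ) * X + C (n₀ : ℚ))) := by
          have := (MulEquiv.irreducible_iff
            (algEquivCMulXAddC ((P : ℤ) : ℚ) (n₀ : ℚ)).toMulEquiv).mpr hgQ
          simpa [comp_eq_aeval] using this
        rw [← hidQ] at hcomp
        exact (irreducible_isUnit_mul (isUnit_C.mpr (IsUnit.mk0 _ (by exact_mod_cast hb0)))).mp
          hcomp
      exact (IsPrimitive.Int.irreducible_iff_irreducible_map_cast hprimG).mpr hirrQ
    · have h1 : 0 < (b g : ℤ) * (G g).leadingCoeff := by rw [hlcG]; positivity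
      have hbpos : (0 : ℤ) < b g := by exact_mod_cast hb g hg
      exact lt_of_mul_lt_mul_left (by simpa using h1) hbpos.le
  have hS2 : ∀ p : ℕ, p.Prime → ∃ n : ℤ, ¬(p : ℤ) ∣ ∏ G' ∈ S, G'.eval n := by
    intro p hp
    by_contra hall
    push Not at hall
    apply hnofix p hp
    intro t
    have := hall t
    rw [Finset.prod_comp (fun G' => G'.eval t) G]
    refine this.trans (Finset.prod_dvd_prod_of_dvd _ _ fun G' hG' => ?_)
    apply dvd_pow_self
    obtain ⟨g, hg, rfl⟩ := Finset.mem_image.mp hG'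
    exact Finset.card_ne_zero_of_mem (Finset.mem_filter.mpr ⟨hg, rfl⟩)
  have hinf := hH S hS1 hS2
  obtain ⟨t, ht, hNt⟩ := hinf.exists_gt (max N 0).toNat
  refine ⟨t, ?_, fun g hg => ?_⟩
  · have h1 : ((max N 0).toNat : ℤ) < t := by exact_mod_cast hNt
    rw [Int.toNat_of_nonneg (le_max_right _ _)] at h1
    exact (le_max_left _ _).trans h1.le
  · have hq : Prime ((G g).eval (t : ℤ)) := ht (G g) (Finset.mem_image_of_mem G hg)
    exact ⟨(G g).eval (t : ℤ), hq, hGeval g hg t, hpoly_eval_modEq g n₀ P (b g) (e g) t⟩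

/-! #### The controlled family of base points and the H-step along it -/

/-- **The H-step along the controlled family.** In the setting of
`exists_prime_cofactors_of_hypothesisH`, fix the data of a
"controlled family": `K`, a base point `n⋆`, the finite set `L₀` of primes dividing `m` or fixed
prime divisors of `∏ g`, and factorizations `g(n⋆) = B_g c_g` with `B_g` supported on `L₀` and
`c_g` coprime to `L₀`, `ℓ B_g ∣ K`, `m B_g ∣ K`. Then for every base point `n₀ ≡ n⋆ (mod K)` and
every choice of finite sets `Λ_g` of large primes dividing `g(n₀)` exactly once and no other
`g'(n₀)`, there are arbitrarily large `n ≡ n⋆ (mod K)` with `g(n) = B_g (∏ Λ_g) q_g`, `q_g` a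
large prime and `q_g ∏ Λ_g ≡ c_g (mod m)`. [cite: Pollack2010MurtyH, §4 (Lemmas 5–6)] -/
theorem exists_prime_cofactors_in_family (hH : Literature.NumberTheory.Sieve.SchinzelHypothesisH)
    {s : Finset ℤ[X]} (hs : ∀ g ∈ s, Irreducible g ∧ 0 < g.natDegree ∧ 0 < g.leadingCoeff)
    {m K : ℕ} (hK : 0 < K) {nstar : ℤ} {L₀ : Finset ℕ} {B : ℤ[X] → ℕ}
    {c : ℤ[X] → ℤ} (hL₀ : ∀ ℓ ∈ L₀, ℓ.Prime)
    (hfix : ∀ p : ℕ, p.Prime → (∀ n : ℤ, (p : ℤ) ∣ ∏ g ∈ s, g.eval n) → p ∈ L₀)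
    (hKL₀ : ∀ p : ℕ, p.Prime → p ∣ K → p ∈ L₀)
    (hB : ∀ g ∈ s, 0 < B g ∧ g.eval nstar = B g * c g ∧ (∀ ℓ ∈ L₀, ¬(ℓ : ℤ) ∣ c g) ∧
      (∀ p : ℕ, p.Prime → p ∣ B g → p ∈ L₀) ∧ (∀ ℓ ∈ L₀, ℓ * B g ∣ K) ∧ m * B g ∣ K)
    {n₀ : ℤ} (hn₀ : n₀ ≡ nstar [ZMOD K]) {Λ : ℤ[X] → Finset ℕ}
    (hΛ : ∀ g ∈ s, ∀ q ∈ Λ g, q.Prime ∧ K < q ∧ (q : ℤ) ∣ g.eval n₀ ∧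
      ¬(q : ℤ) ^ 2 ∣ g.eval n₀ ∧ ∀ g' ∈ s, g' ≠ g → ¬(q : ℤ) ∣ g'.eval n₀)
    (N : ℤ) :
    ∃ n : ℤ, N ≤ n ∧ n ≡ nstar [ZMOD K] ∧ ∀ g ∈ s, ∃ q : ℤ, Prime q ∧ N ≤ q ∧
      g.eval n = B g * (∏ p ∈ Λ g, (p : ℤ)) * q ∧
        q * (∏ p ∈ Λ g, (p : ℤ)) ≡ c g [ZMOD m] := by
  classical
  -- Step 1: `g(n₀) = B_g E_g` with `E_g ≡ c_g (mod m)` and `E_g` coprime to `L₀`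
  have hdec : ∀ g ∈ s, ∃ E : ℤ, g.eval n₀ = B g * E ∧ E ≡ c g [ZMOD m] ∧
      ∀ ℓ ∈ L₀, ¬(ℓ : ℤ) ∣ E := by
    intro g hg
    obtain ⟨hB0, hBc, hcL₀, -, hℓBK, hmBK⟩ := hB g hg
    obtain ⟨K₁, hK₁⟩ := hmBK
    obtain ⟨x, hx⟩ := Int.modEq_iff_dvd.mp (eval_modEq_of_modEq g hn₀).symm
    refine ⟨c g + m * K₁ * x, ?_, ?_, ?_⟩
    · have h1 : g.eval n₀ = g.eval nstar + K * x := by linarith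
      rw [h1, hBc, hK₁]
      push_cast
      ring
    · rw [Int.modEq_iff_dvd]
      exact ⟨-(K₁ * x), by ring⟩
    · intro ℓ hℓ hdvd
      apply hcL₀ ℓ hℓ
      obtain ⟨y, hy⟩ := hℓBK ℓ hℓ
      have h1 : m * K₁ = ℓ * y := by
        apply Nat.eq_of_mul_eq_mul_left hB0
        calc B g * (m * K₁) = m * B g * K₁ := by ring
          _ = ℓ * B g * y := by rw [← hK₁, hy]
          _ = B g * (ℓ * y) := by ring
      have h2 : (ℓ : ℤ) ∣ (m : ℤ) * K₁ * x :=
        ⟨y * x, by rw [show (m : ℤ) * K₁ = ℓ * y by exact_mod_cast h1]; ring⟩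
      exact (dvd_add_left h2).mp hdvd
  choose! E hE using hdec
  -- Step 2: the primes of `Λ_g` divide `E_g`
  have hdec2 : ∀ g ∈ s, ∃ e' : ℤ, E g = (∏ p ∈ Λ g, (p : ℤ)) * e' := by
    intro g hg
    obtain ⟨hEg, -, -⟩ := hE g hg
    obtain ⟨hB0, -, -, -, -, hmBK⟩ := hB g hg
    have hBleK : B g ≤ K := Nat.le_of_dvd hK (dvd_of_mul_left_dvd hmBK)
    have hdivs : ∀ q ∈ Λ g, q ∣ (E g).natAbs := by
      intro q hq
      obtain ⟨hqp, hKq, hqd, -, -⟩ := hΛ g hg q hq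
      have hqZ : Prime (q : ℤ) := Nat.prime_iff_prime_int.mp hqp
      rw [hEg] at hqd
      rcases hqZ.dvd_or_dvd hqd with h | h
      · exfalso
        have : q ≤ B g := Nat.le_of_dvd hB0 (Int.natCast_dvd_natCast.mp h)
        omega
      · exact Int.natCast_dvd.mp h
    have hprod : (∏ p ∈ Λ g, p) ∣ (E g).natAbs :=
      Finset.prod_primes_dvd _ (fun q hq => Nat.prime_iff.mp (hΛ g hg q hq).1) hdivs
    have : ((∏ p ∈ Λ g, p : ℕ) : ℤ) ∣ E g := Int.natCast_dvd.mpr hprod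
    rw [Nat.cast_prod] at this
    exact this
  choose! e' he' using hdec2
  -- Step 3: the data fed to the H-step
  set L : Finset ℕ := L₀ ∪ s.biUnion Λ with hLdef
  set b : ℤ[X] → ℕ := fun g => B g * ∏ p ∈ Λ g, p with hbdef
  set P : ℕ := K * (∏ ℓ ∈ L, ℓ) * ∏ g ∈ s, b g with hPdef
  have hLprime : ∀ ℓ ∈ L, ℓ.Prime := by
    intro ℓ hℓ
    rcases Finset.mem_union.mp hℓ with h | h
    · exact hL₀ ℓ h
    · obtain ⟨g, hg, hq⟩ := Finset.mem_biUnion.mp h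
      exact (hΛ g hg ℓ hq).1
  have hbpos : ∀ g ∈ s, 0 < b g := fun g hg =>
    mul_pos (hB g hg).1 (Finset.prod_pos fun q hq => (hΛ g hg q hq).1.pos)
  have hbe : ∀ g ∈ s, g.eval n₀ = b g * e' g := by
    intro g hg
    rw [(hE g hg).1, he' g hg]
    simp only [hbdef]
    push_cast
    ring
  have hcop : ∀ g ∈ s, ∀ ℓ ∈ L, ¬(ℓ : ℤ) ∣ e' g := by
    intro g hg ℓ hℓ hdvd
    have he'E : e' g ∣ E g := ⟨∏ p ∈ Λ g, (p : ℤ), by rw [he' g hg]; ring⟩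
    rcases Finset.mem_union.mp hℓ with h | h
    · exact (hE g hg).2.2 ℓ h (hdvd.trans he'E)
    · obtain ⟨g'', hg'', hq⟩ := Finset.mem_biUnion.mp h
      by_cases hgg : g'' = g
      · subst hgg
        apply (hΛ g'' hg'' ℓ hq).2.2.2.1
        rw [(hE g'' hg).1, he' g'' hg, sq]
        exact Dvd.dvd.mul_left (mul_dvd_mul (Finset.dvd_prod_of_mem _ hq) hdvd) _
      · apply (hΛ g'' hg'' ℓ hq).2.2.2.2 g hg (Ne.symm hgg)
        rw [hbe g hg]
        exact Dvd.dvd.mul_left hdvd _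
  have hPpos : 0 < P :=
    mul_pos (mul_pos hK (Finset.prod_pos fun ℓ hℓ => (hLprime ℓ hℓ).pos))
      (Finset.prod_pos fun g hg => hbpos g hg)
  have hL₀L : L₀ ⊆ L := Finset.subset_union_left
  have hfixL : ∀ p : ℕ, p.Prime → (∀ n : ℤ, (p : ℤ) ∣ ∏ g ∈ s, g.eval n) → p ∈ L :=
    fun p hp h => hL₀L (hfix p hp h)
  have hPL : ∀ p : ℕ, p.Prime → p ∣ P → p ∈ L := by
    intro p hp hpd
    rcases (Nat.Prime.dvd_mul hp).mp hpd with h | h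
    · rcases (Nat.Prime.dvd_mul hp).mp h with h | h
      · exact hL₀L (hKL₀ p hp h)
      · obtain ⟨ℓ, hℓ, hpℓ⟩ := (Nat.Prime.prime hp).exists_mem_finset_dvd h
        rwa [(Nat.prime_dvd_prime_iff_eq hp (hLprime ℓ hℓ)).mp hpℓ]
    · obtain ⟨g, hg, hpg⟩ := (Nat.Prime.prime hp).exists_mem_finset_dvd h
      rcases (Nat.Prime.dvd_mul hp).mp hpg with h | h
      · exact hL₀L ((hB g hg).2.2.2.1 p hp h)
      · obtain ⟨q, hq, hpq⟩ := (Nat.Prime.prime hp).exists_mem_finset_dvd h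
        rw [(Nat.prime_dvd_prime_iff_eq hp (hΛ g hg q hq).1).mp hpq]
        exact Finset.mem_union_right _ (Finset.mem_biUnion.mpr ⟨g, hg, hq⟩)
  have hbP : ∀ g ∈ s, b g ∣ P := fun g hg =>
    (Finset.dvd_prod_of_mem b hg).trans (Dvd.intro_left _ rfl)
  -- growth thresholds
  have hgrow : ∀ g ∈ s, ∃ n₁ : ℤ, ∀ n, n₁ ≤ n → (b g : ℤ) * max N 1 ≤ g.eval n := fun g hg =>
    exists_forall_le_eval (hs g hg).2.1 (hs g hg).2.2 _
  choose! n₁ hn₁ using hgrow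
  set M : ℤ := ∑ g ∈ s, |n₁ g| with hM
  have hMge : ∀ g ∈ s, n₁ g ≤ M := fun g hg =>
    (le_abs_self _).trans (Finset.single_le_sum (fun g _ => abs_nonneg (n₁ g)) hg)
  -- apply the H-step
  obtain ⟨t, ht, hq⟩ := exists_prime_cofactors_of_hypothesisH hH hs n₀ hfixL hbpos hbe hcop hPpos
    hPL hbP (max 0 (max (N - n₀) (M - n₀)))
  set n : ℤ := (P : ℤ) * t + n₀ with hn
  have ht0 : 0 ≤ t := (le_max_left _ _).trans ht
  have htn : t + n₀ ≤ n := by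
    have : t ≤ (P : ℤ) * t := le_mul_of_one_le_left ht0 (by exact_mod_cast hPpos)
    linarith
  have hNt : N - n₀ ≤ t := ((le_max_left _ _).trans (le_max_right _ _)).trans ht
  have hMt : M - n₀ ≤ t := ((le_max_right _ _).trans (le_max_right _ _)).trans ht
  refine ⟨n, by linarith, ?_, ?_⟩
  · have hKP : (K : ℤ) ∣ (P : ℤ) := by
      exact_mod_cast (⟨(∏ ℓ ∈ L, ℓ) * ∏ g ∈ s, b g, by rw [hPdef]; ring⟩ : K ∣ P)
    obtain ⟨P₁, hP₁⟩ := hKP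
    calc n ≡ n₀ [ZMOD K] := by
          rw [Int.modEq_iff_dvd]
          exact ⟨-(P₁ * t), by rw [hn, hP₁]; ring⟩
      _ ≡ nstar [ZMOD K] := hn₀
  · intro g hg
    obtain ⟨q, hqprime, hgq, hqmod⟩ := hq g hg
    have hbg0 : (0 : ℤ) < b g := by exact_mod_cast hbpos g hg
    have hqN : max N 1 ≤ q := by
      have h1 := hn₁ g hg n ((hMge g hg).trans (by linarith))
      rw [hgq] at h1
      exact le_of_mul_le_mul_left h1 hbg0
    refine ⟨q, hqprime, (le_max_left _ _).trans hqN, ?_, ?_⟩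
    · rw [hgq]
      simp only [hbdef]
      push_cast
      ring
    · have hmP : (m : ℤ) ∣ ((P / b g : ℕ) : ℤ) := by
        have h1 : P / b g = K * (∏ ℓ ∈ L, ℓ) * ∏ g' ∈ s.erase g, b g' := by
          rw [hPdef, ← Finset.mul_prod_erase s b hg,
            show K * (∏ ℓ ∈ L, ℓ) * (b g * ∏ x ∈ s.erase g, b x) =
              b g * (K * (∏ ℓ ∈ L, ℓ) * ∏ x ∈ s.erase g, b x) by ring]
          exact Nat.mul_div_cancel_left _ (hbpos g hg)
        rw [h1]
        have hmK : m ∣ K := dvd_of_mul_right_dvd (hB g hg).2.2.2.2.2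
        exact_mod_cast (hmK.trans (Dvd.intro _ rfl)).trans (Dvd.intro _ rfl)
      have h1 : q ≡ e' g [ZMOD m] := hqmod.of_dvd hmP
      calc q * ∏ p ∈ Λ g, (p : ℤ) ≡ e' g * ∏ p ∈ Λ g, (p : ℤ) [ZMOD m] := h1.mul_right _
        _ = E g := by rw [he' g hg]; ring
        _ ≡ c g [ZMOD m] := (hE g hg).2.1

/-- **Existence of a controlled family** for a finite set `s` of non-constant integer
polynomials: `K`, `n⋆` with `∏ g (n⋆) ≠ 0`, the primes `L₀` dividing `m` or dividing every value
of `∏ g`, and the `L₀`-parts `B_g` of `g(n⋆)`. [folklore] -/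
theorem exists_family {s : Finset ℤ[X]}
    (hs : ∀ g ∈ s, Irreducible g ∧ 0 < g.natDegree ∧ 0 < g.leadingCoeff) {m : ℕ} (hm : 0 < m) :
    ∃ (K : ℕ) (nstar : ℤ) (L₀ : Finset ℕ) (B : ℤ[X] → ℕ) (c : ℤ[X] → ℤ),
      0 < K ∧ (∀ ℓ ∈ L₀, ℓ.Prime ∧ (ℓ ∣ m ∨ ∀ n : ℤ, (ℓ : ℤ) ∣ ∏ g ∈ s, g.eval n)) ∧
      (∀ p : ℕ, p.Prime → (∀ n : ℤ, (p : ℤ) ∣ ∏ g ∈ s, g.eval n) → p ∈ L₀) ∧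
      (∀ p : ℕ, p.Prime → p ∣ K → p ∈ L₀) ∧
      (∀ g ∈ s, 0 < B g ∧ g.eval nstar = B g * c g ∧ (∀ ℓ ∈ L₀, ¬(ℓ : ℤ) ∣ c g) ∧
        (∀ p : ℕ, p.Prime → p ∣ B g → p ∈ L₀) ∧ (∀ ℓ ∈ L₀, ℓ * B g ∣ K) ∧ m * B g ∣ K) := by
  classical
  set F := ∏ g ∈ s, g with hF
  have hF0 : F ≠ 0 := Finset.prod_ne_zero_iff.mpr fun g hg h0 => by
    have := (hs g hg).2.1
    rw [h0, natDegree_zero] at this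
    exact lt_irrefl _ this
  have hFeval : ∀ n, F.eval n = ∏ g ∈ s, g.eval n := fun n => eval_prod _ _ _
  obtain ⟨nstar, hnstar⟩ : ∃ n : ℤ, F.eval n ≠ 0 := by
    by_contra h
    push Not at h
    apply hF0
    apply eq_zero_of_infinite_isRoot
    have hroots : {x | F.IsRoot x} = Set.univ := Set.eq_univ_iff_forall.mpr fun x => h x
    rw [hroots]
    exact Set.infinite_univ
  set L₀ := (m * (F.eval nstar).natAbs).primeFactors.filter
    (fun p => p ∣ m ∨ ∀ n : ℤ, (p : ℤ) ∣ ∏ g ∈ s, g.eval n) with hL₀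
  have hL₀prime : ∀ ℓ ∈ L₀, ℓ.Prime := fun ℓ hℓ =>
    Nat.prime_of_mem_primeFactors (Finset.mem_filter.mp hℓ).1
  have hne : m * (F.eval nstar).natAbs ≠ 0 := mul_ne_zero hm.ne' (Int.natAbs_ne_zero.mpr hnstar)
  have hBc : ∀ g : ℤ[X], ∃ (Bg : ℕ) (cg : ℤ), g ∈ s → (0 < Bg ∧ g.eval nstar = Bg * cg ∧
      (∀ ℓ ∈ L₀, ¬(ℓ : ℤ) ∣ cg) ∧ ∀ p, p.Prime → p ∣ Bg → p ∈ L₀) := by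
    intro g
    by_cases hg : g ∈ s
    · have hg0 : g.eval nstar ≠ 0 := fun h =>
        hnstar (by rw [hFeval]; exact Finset.prod_eq_zero hg h)
      obtain ⟨Bg, cg, h1, h2, h3, h4⟩ := exists_lpart L₀ hL₀prime hg0
      exact ⟨Bg, cg, fun _ => ⟨h1, h2, h3, h4⟩⟩
    · exact ⟨1, 0, fun h => absurd h hg⟩
  choose B c hBc using hBc
  set K := m * (∏ ℓ ∈ L₀, ℓ) * ∏ g ∈ s, B g with hK
  refine ⟨K, nstar, L₀, B, c, ?_, ?_, ?_, ?_, ?_⟩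
  · exact mul_pos (mul_pos hm (Finset.prod_pos fun ℓ hℓ => (hL₀prime ℓ hℓ).pos))
      (Finset.prod_pos fun g hg => (hBc g hg).1)
  · intro ℓ hℓ
    obtain ⟨h1, h2⟩ := Finset.mem_filter.mp hℓ
    exact ⟨Nat.prime_of_mem_primeFactors h1, h2⟩
  · intro p hp hall
    refine Finset.mem_filter.mpr ⟨?_, Or.inr hall⟩
    rw [Nat.mem_primeFactors]
    refine ⟨hp, Dvd.dvd.mul_left (Int.natCast_dvd.mp ?_) _, hne⟩
    rw [hFeval]
    exact hall nstar
  · intro p hp hpK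
    rcases (Nat.Prime.dvd_mul hp).mp hpK with h | h
    · rcases (Nat.Prime.dvd_mul hp).mp h with h | h
      · refine Finset.mem_filter.mpr ⟨?_, Or.inl h⟩
        rw [Nat.mem_primeFactors]
        exact ⟨hp, h.mul_right _, hne⟩
      · obtain ⟨ℓ, hℓ, hpℓ⟩ := (Nat.Prime.prime hp).exists_mem_finset_dvd h
        rwa [(Nat.prime_dvd_prime_iff_eq hp (hL₀prime ℓ hℓ)).mp hpℓ]
    · obtain ⟨g, hg, hpg⟩ := (Nat.Prime.prime hp).exists_mem_finset_dvd h
      exact (hBc g hg).2.2.2 p hp hpg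
  · intro g hg
    obtain ⟨h1, h2, h3, h4⟩ := hBc g hg
    refine ⟨h1, h2, h3, h4, fun ℓ hℓ => ?_, ?_⟩
    · have := mul_dvd_mul (Finset.dvd_prod_of_mem (fun x => x) hℓ) (Finset.dvd_prod_of_mem B hg)
      exact this.trans ⟨m, by rw [hK]; ring⟩
    · exact (mul_dvd_mul_left m (Finset.dvd_prod_of_mem B hg)).trans ⟨∏ ℓ ∈ L₀, ℓ, by rw [hK]; ring⟩

/-! #### Reductions: squarefree part, non-vanishing, the unit `a` -/

/-- An `E′`-polynomial may be replaced by the product of its distinct non-constant normalized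
irreducible factors (Pollack's Lemma 5, the part not needing H).
[cite: Pollack2010MurtyH, §4 Lemma 5] -/
theorem reduce_squarefree {f : ℤ[X]} {a : ℤ} {m : ℕ} (hf : IsEPrimePolynomial f a m)
    (hf0 : f ≠ 0) :
    ∃ s : Finset ℤ[X], (∀ g ∈ s, Irreducible g ∧ 0 < g.natDegree ∧ 0 < g.leadingCoeff) ∧
      (∀ g ∈ s, ∀ g' ∈ s, Associated g g' → g = g') ∧ IsEPrimePolynomial (∏ g ∈ s, g) a m := by
  classical
  set nf := UniqueFactorizationMonoid.normalizedFactors f with hnf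
  set s := nf.toFinset.filter (fun g => 0 < g.natDegree) with hsdef
  have hmem : ∀ g ∈ s, g ∈ nf ∧ 0 < g.natDegree := fun g hg => by
    have := Finset.mem_filter.mp hg
    exact ⟨Multiset.mem_toFinset.mp this.1, this.2⟩
  refine ⟨s, ?_, ?_, ?_⟩
  · intro g hg
    obtain ⟨hgnf, hdeg⟩ := hmem g hg
    have hirr : Irreducible g := UniqueFactorizationMonoid.irreducible_of_normalized_factor g hgnf
    have hnorm : normalize g = g := UniqueFactorizationMonoid.normalize_normalized_factor g hgnf
    refine ⟨hirr, hdeg, ?_⟩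
    have hlc : g.leadingCoeff = normalize g.leadingCoeff := by
      rw [← leadingCoeff_normalize, hnorm]
    rw [hlc, ← Int.abs_eq_normalize]
    exact abs_pos.mpr (leadingCoeff_ne_zero.mpr hirr.ne_zero)
  · intro g hg g' hg' hass
    rw [← UniqueFactorizationMonoid.normalize_normalized_factor g (hmem g hg).1,
      ← UniqueFactorizationMonoid.normalize_normalized_factor g' (hmem g' hg').1]
    exact normalize_eq_normalize hass.dvd hass.symm.dvd
  · have hFdvd : (∏ g ∈ s, g) ∣ f := by
      have h1 : (∏ g ∈ s, g) ∣ ∏ g ∈ nf.toFinset, g :=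
        Finset.prod_dvd_prod_of_subset _ _ _ (Finset.filter_subset _ _)
      have h2 : (∏ g ∈ nf.toFinset, g) ∣ nf.prod := by
        simpa using Multiset.toFinset_prod_dvd_prod nf
      exact h1.trans (h2.trans (UniqueFactorizationMonoid.prod_normalizedFactors hf0).dvd)
    refine ⟨?_, ?_⟩
    · filter_upwards [hf.1] with n hn
      obtain ⟨p, hp, hpa, hpd⟩ := hn
      refine ⟨p, hp, hpa, ?_⟩
      have hpZ : Prime (p : ℤ) := Nat.prime_iff_prime_int.mp hp
      obtain ⟨u, hu⟩ := UniqueFactorizationMonoid.prod_normalizedFactors hf0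
      have h1 : (p : ℤ) ∣ (nf.map (eval (n : ℤ))).prod := by
        rw [← hu, eval_mul, eval_multiset_prod] at hpd
        obtain ⟨r, hr, hru⟩ := Polynomial.isUnit_iff.mp u.isUnit
        rw [← hru, eval_C] at hpd
        exact (hpZ.dvd_or_dvd hpd).resolve_right fun h => hpZ.not_unit (isUnit_of_dvd_unit h hr)
      obtain ⟨x, hx, hpx⟩ := hpZ.exists_mem_multiset_dvd h1
      obtain ⟨q, hq, rfl⟩ := Multiset.mem_map.mp hx
      have hqdeg : 0 < q.natDegree := by
        by_contra h0
        push Not at h0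
        have hqC : q = C (q.coeff 0) := eq_C_of_natDegree_eq_zero (Nat.le_zero.mp h0)
        obtain ⟨n', hn'⟩ := hf.2 p hp hpa
        apply hn'
        have hqf : q ∣ f := UniqueFactorizationMonoid.dvd_of_mem_normalizedFactors hq
        have h2 : q.eval (n : ℤ) ∣ f.eval n' := by
          have := eval_dvd (x := n') hqf
          rw [hqC, eval_C] at this ⊢
          exact this
        exact hpx.trans h2
      have hqs : q ∈ s := Finset.mem_filter.mpr ⟨Multiset.mem_toFinset.mpr hq, hqdeg⟩
      rw [eval_prod]
      exact hpx.trans (Finset.dvd_prod_of_mem _ hqs)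
    · intro p hp hpa
      obtain ⟨n, hn⟩ := hf.2 p hp hpa
      exact ⟨n, fun h => hn (h.trans (eval_dvd hFdvd))⟩

/-- An `E′`-polynomial is non-zero ((i) produces a prime `≡ a`, which by (ii) misses some value).
[cite: Pollack2010MurtyH, §2.2] -/
theorem _root_.Literature.Barriers.Parity.IsEPrimePolynomial.ne_zero {f : ℤ[X]} {a : ℤ} {m : ℕ}
    (hf : IsEPrimePolynomial f a m) : f ≠ 0 := by
  rintro rfl
  obtain ⟨n, p, hp, hpa, -⟩ := hf.1.exists
  obtain ⟨n', hn'⟩ := hf.2 p hp hpa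
  exact hn' (by simp)

/-- For an `E′`-polynomial the residue `a` is a unit `mod m` (otherwise the only prime `≡ a`
would be a prime `p ∣ gcd(a, m)`, which by (ii) misses the values along a progression `mod p`,
contradicting (i)). [cite: Pollack2010MurtyH, §2.2 (definition of E′-polynomial)] -/
theorem _root_.Literature.Barriers.Parity.IsEPrimePolynomial.isUnit_cast {f : ℤ[X]} {a : ℤ}
    {m : ℕ} (hf : IsEPrimePolynomial f a m) (hm : 0 < m) : IsUnit (a : ZMod m) := by
  by_contra hu
  rw [ZMod.coe_int_isUnit_iff_isCoprime, Int.isCoprime_iff_gcd_eq_one] at hu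
  have hg0 : Int.gcd (m : ℤ) a ≠ 0 := by
    rw [Ne, Int.gcd_eq_zero_iff]
    exact fun h => hm.ne' (by exact_mod_cast h.1)
  obtain ⟨p, hp, hpg⟩ := Nat.exists_prime_and_dvd hu
  have hpm : (p : ℤ) ∣ (m : ℤ) := (Int.natCast_dvd_natCast.mpr hpg).trans (Int.gcd_dvd_left _ _)
  have hpa : (p : ℤ) ∣ a := (Int.natCast_dvd_natCast.mpr hpg).trans (Int.gcd_dvd_right _ _)
  -- every prime `≡ a (mod m)` is `p`
  have honly : ∀ q : ℕ, q.Prime → (q : ℤ) ≡ a [ZMOD m] → q = p := by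
    intro q hq hqa
    have h1 : (p : ℤ) ∣ (q : ℤ) := by
      have := (hpm.trans hqa.dvd)
      -- p ∣ a - q and p ∣ a
      have h2 := (Int.dvd_sub hpa this)
      simpa using h2
    exact ((Nat.prime_dvd_prime_iff_eq hp hq).mp (Int.natCast_dvd_natCast.mp h1)).symm
  obtain ⟨N, hN⟩ := Filter.eventually_atTop.mp hf.1
  obtain ⟨p₀, hp₀, hp₀a, -⟩ := hN N le_rfl
  obtain rfl := honly p₀ hp₀ hp₀a
  obtain ⟨n₁, hn₁⟩ := hf.2 _ hp₀ hp₀a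
  -- a large natural number `≡ n₁ (mod p₀)`
  set n : ℕ := N + ((n₁ - N) % (p₀ : ℤ)).toNat with hn
  obtain ⟨q, hq, hqa, hqd⟩ := hN n (Nat.le_add_right _ _)
  obtain rfl := honly q hq hqa
  apply hn₁
  have hmod : (n : ℤ) ≡ n₁ [ZMOD q] := by
    have h0 : 0 ≤ (n₁ - N) % (q : ℤ) := Int.emod_nonneg _ (by exact_mod_cast hq.ne_zero)
    rw [hn]
    push_cast
    rw [Int.toNat_of_nonneg h0]
    calc (N : ℤ) + (n₁ - N) % q ≡ N + (n₁ - N) [ZMOD q] :=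
        Int.ModEq.add_left _ (Int.mod_modEq _ _)
      _ = n₁ := by ring
  have := eval_modEq_of_modEq f hmod
  rw [Int.dvd_iff_emod_eq_zero] at hqd ⊢
  rwa [this] at hqd

/-! #### Chinese remainder helpers -/

/-- Transport of a natural-number CRT solution to an integer congruence. [folklore] -/
private theorem crt_aux {k M : ℕ} {r : ℤ} (hM : 0 < M) (h : k ≡ (r % (M : ℤ)).toNat [MOD M]) :
    (k : ℤ) ≡ r [ZMOD M] := by
  have h1 := Int.natCast_modEq_iff.mpr h
  rw [Int.toNat_of_nonneg (Int.emod_nonneg r (by exact_mod_cast hM.ne'))] at h1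
  exact h1.trans (Int.mod_modEq r M)

/-- Chinese remainder theorem for integer residues and finitely many pairwise coprime moduli.
[folklore] -/
private theorem crt_finset {ι : Type*} (T : Finset ι) (md : ι → ℕ) (r : ι → ℤ)
    (h0 : ∀ i ∈ T, 0 < md i) (hcop : Set.Pairwise (T : Set ι) (Function.onFun Nat.Coprime md)) :
    ∃ n : ℤ, ∀ i ∈ T, n ≡ r i [ZMOD md i] := by
  obtain ⟨k, hk⟩ := Nat.chineseRemainderOfFinset (fun i => (r i % (md i : ℤ)).toNat) md T
    (fun i hi => (h0 i hi).ne') hcop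
  exact ⟨k, fun i hi => crt_aux (h0 i hi) (hk i hi)⟩

/-- Chinese remainder theorem for two coprime moduli, integer residues. [folklore] -/
private theorem crt_two {M₁ M₂ : ℕ} (h1 : 0 < M₁) (h2 : 0 < M₂) (hc : Nat.Coprime M₁ M₂)
    (r₁ r₂ : ℤ) : ∃ n : ℤ, n ≡ r₁ [ZMOD M₁] ∧ n ≡ r₂ [ZMOD M₂] := by
  obtain ⟨k, hk1, hk2⟩ := Nat.chineseRemainder hc (r₁ % (M₁ : ℤ)).toNat (r₂ % (M₂ : ℤ)).toNat
  exact ⟨k, crt_aux h1 hk1, crt_aux h2 hk2⟩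

/-- Divisibility by a divisor of the modulus is invariant under congruence. [folklore] -/
private theorem dvd_iff_of_modEq {x y M d : ℤ} (h : x ≡ y [ZMOD M]) (hd : d ∣ M) :
    d ∣ x ↔ d ∣ y := by
  have h' := h.of_dvd hd
  rw [Int.dvd_iff_emod_eq_zero, Int.dvd_iff_emod_eq_zero, h']

/-! #### Stage A: Pollack's contradiction — some factor has only prime divisors `≡ 1, a` -/

/-- **Stage A** (the proof of Theorem 1 in print): among the factors `g` with `c_g ≡ a`, some
`g₀` has the property that every sufficiently large prime dividing some `g₀(n)` (`n` in the
controlled family) exactly once is `≡ 1` or `≡ a (mod m)`. Otherwise choose for each such `g` a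
bad prime `p_g ∉ {1, a}` with an exact-division witness, combine the witnesses by the Chinese
remainder theorem and run the H-step: the resulting value of `∏ g` has no prime factor `≡ a`,
contradicting (i). [cite: Pollack2010MurtyH, §4 (proof of Theorem 1)] -/
theorem exists_factor_with_good_primes {s : Finset ℤ[X]} {m : ℕ} {a : ℤ} (ha : IsUnit (a : ZMod m))
    {K : ℕ} (hK : 0 < K) {nstar : ℤ} {B : ℤ[X] → ℕ} {c : ℤ[X] → ℤ}
    (hBa : ∀ g ∈ s, ∀ p : ℕ, p.Prime → p ∣ B g → ¬(p : ℤ) ≡ a [ZMOD m])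
    {ρ : ℕ} (hρ : ∀ g ∈ s, ∀ g' ∈ s, g ≠ g' → ∀ p : ℕ, p.Prime → ∀ n : ℤ,
      (p : ℤ) ∣ g.eval n → (p : ℤ) ∣ g'.eval n → p ≤ ρ)
    (HF : ∀ n₀ : ℤ, n₀ ≡ nstar [ZMOD K] → ∀ Λ : ℤ[X] → Finset ℕ,
      (∀ g ∈ s, ∀ q ∈ Λ g, q.Prime ∧ K < q ∧ (q : ℤ) ∣ g.eval n₀ ∧ ¬(q : ℤ) ^ 2 ∣ g.eval n₀ ∧
        ∀ g' ∈ s, g' ≠ g → ¬(q : ℤ) ∣ g'.eval n₀) →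
      ∀ N : ℤ, ∃ n : ℤ, N ≤ n ∧ n ≡ nstar [ZMOD K] ∧ ∀ g ∈ s, ∃ q : ℤ, Prime q ∧ N ≤ q ∧
        g.eval n = B g * (∏ p ∈ Λ g, (p : ℤ)) * q ∧ q * (∏ p ∈ Λ g, (p : ℤ)) ≡ c g [ZMOD m])
    (hEi : ∃ N₀ : ℤ, ∀ n : ℤ, N₀ ≤ n → ∃ p : ℕ, p.Prime ∧ (p : ℤ) ≡ a [ZMOD m] ∧
      (p : ℤ) ∣ ∏ g ∈ s, g.eval n) :
    ∃ g₀ ∈ s, c g₀ ≡ a [ZMOD m] ∧ ∃ N : ℕ, ∀ q : ℕ, q.Prime → N ≤ q →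
      (∃ n : ℤ, n ≡ nstar [ZMOD K] ∧ (q : ℤ) ∣ g₀.eval n ∧ ¬(q : ℤ) ^ 2 ∣ g₀.eval n) →
      ((q : ℤ) ≡ 1 [ZMOD m] ∨ (q : ℤ) ≡ a [ZMOD m]) := by
  classical
  by_contra hcon
  push Not at hcon
  set R := s.filter (fun g => c g ≡ a [ZMOD m]) with hR
  have hRs : R ⊆ s := Finset.filter_subset _ _
  have hRc : ∀ g ∈ R, c g ≡ a [ZMOD m] := fun g hg => (Finset.mem_filter.mp hg).2
  -- sequential choice of distinct bad primes with exact-division witnesses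
  have hchoice : ∀ T : Finset ℤ[X], T ⊆ R → ∃ (p : ℤ[X] → ℕ) (w : ℤ[X] → ℤ),
      (∀ g ∈ T, (p g).Prime ∧ max ρ K < p g ∧ w g ≡ nstar [ZMOD K] ∧
        (p g : ℤ) ∣ g.eval (w g) ∧ ¬(p g : ℤ) ^ 2 ∣ g.eval (w g) ∧
        ¬(p g : ℤ) ≡ 1 [ZMOD m] ∧ ¬(p g : ℤ) ≡ a [ZMOD m]) ∧
      ∀ g ∈ T, ∀ g' ∈ T, g ≠ g' → p g ≠ p g' := by
    intro T
    induction T using Finset.induction_on with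
    | empty => intro; exact ⟨fun _ => 0, fun _ => 0, by simp, by simp⟩
    | insert g T hgT ih =>
      intro hT
      obtain ⟨p, w, hp, hinj⟩ := ih ((Finset.subset_insert g T).trans hT)
      have hgR : g ∈ R := hT (Finset.mem_insert_self g T)
      obtain ⟨q, hq, hNq, ⟨n, hn, hqd, hqsq⟩, hq1, hqa⟩ :=
        hcon g (hRs hgR) (hRc g hgR) (max ρ K + 1 + ∑ g' ∈ T, p g')
      have hbig : ∀ g' ∈ T, p g' < q := fun g' hg' =>
        lt_of_le_of_lt (Finset.single_le_sum (fun _ _ => Nat.zero_le _) hg') (by omega)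
      refine ⟨Function.update p g q, Function.update w g n, ?_, ?_⟩
      · intro g' hg'
        rcases Finset.mem_insert.mp hg' with rfl | hg'T
        · simp only [Function.update_self]
          exact ⟨hq, by omega, hn, hqd, hqsq, hq1, hqa⟩
        · have hne : g' ≠ g := fun h => hgT (h ▸ hg'T)
          simp only [Function.update_of_ne hne]
          exact hp g' hg'T
      · intro g₁ hg₁ g₂ hg₂ hne
        rcases Finset.mem_insert.mp hg₁ with rfl | hg₁T <;>
          rcases Finset.mem_insert.mp hg₂ with rfl | hg₂T
        · exact absurd rfl hne
        · rw [Function.update_self, Function.update_of_ne (Ne.symm hne)]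
          exact (hbig g₂ hg₂T).ne'
        · rw [Function.update_of_ne hne, Function.update_self]
          exact (hbig g₁ hg₁T).ne
        · have h1 : g₁ ≠ g := fun h => hgT (h ▸ hg₁T)
          have h2 : g₂ ≠ g := fun h => hgT (h ▸ hg₂T)
          rw [Function.update_of_ne h1, Function.update_of_ne h2]
          exact hinj g₁ hg₁T g₂ hg₂T hne
  obtain ⟨p, w, hp, hinj⟩ := hchoice R subset_rfl
  -- Chinese remainder: `n₀ ≡ n⋆ (mod K)`, `n₀ ≡ w_g (mod p_g²)` for `g ∈ R`
  set md : Option ℤ[X] → ℕ := fun o => o.elim K (fun g => p g ^ 2) with hmd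
  set r : Option ℤ[X] → ℤ := fun o => o.elim nstar w with hr
  have h0 : ∀ i ∈ Finset.insertNone R, 0 < md i := by
    intro i hi
    cases i with
    | none => exact hK
    | some g => exact pow_pos (hp g (Finset.some_mem_insertNone.mp hi)).1.pos 2
  have hpK : ∀ g ∈ R, Nat.Coprime K (p g) := fun g hg =>
    Nat.coprime_comm.mp ((Nat.Prime.coprime_iff_not_dvd (hp g hg).1).mpr fun h => by
      have := Nat.le_of_dvd hK h
      have := (hp g hg).2.1
      omega)
  have hcop : Set.Pairwise (Finset.insertNone R : Set (Option ℤ[X]))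
      (Function.onFun Nat.Coprime md) := by
    intro i hi j hj hij
    cases i with
    | none =>
      cases j with
      | none => exact absurd rfl hij
      | some g =>
        exact Nat.Coprime.pow_right 2 (hpK g (Finset.some_mem_insertNone.mp hj))
    | some g =>
      cases j with
      | none =>
        exact Nat.Coprime.pow_left 2 (hpK g (Finset.some_mem_insertNone.mp hi)).symm
      | some g' =>
        have hg := Finset.some_mem_insertNone.mp hi
        have hg' := Finset.some_mem_insertNone.mp hj
        have hne : g ≠ g' := fun h => hij (by rw [h])
        exact Nat.Coprime.pow 2 2
          ((Nat.coprime_primes (hp g hg).1 (hp g' hg').1).mpr (hinj g hg g' hg' hne))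
  obtain ⟨n₀, hn₀⟩ := crt_finset (Finset.insertNone R) md r h0 hcop
  have hn₀K : n₀ ≡ nstar [ZMOD K] := hn₀ none Finset.none_mem_insertNone
  have hn₀w : ∀ g ∈ R, n₀ ≡ w g [ZMOD (p g : ℤ) ^ 2] := fun g hg => by
    have := hn₀ (some g) (Finset.some_mem_insertNone.mpr hg)
    simp only [hmd, hr, Option.elim_some] at this
    exact_mod_cast this
  -- the prescribed primes
  set Λ : ℤ[X] → Finset ℕ := fun g => if g ∈ R then {p g} else ∅ with hΛdef
  have hΛ : ∀ g ∈ s, ∀ q ∈ Λ g, q.Prime ∧ K < q ∧ (q : ℤ) ∣ g.eval n₀ ∧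
      ¬(q : ℤ) ^ 2 ∣ g.eval n₀ ∧ ∀ g' ∈ s, g' ≠ g → ¬(q : ℤ) ∣ g'.eval n₀ := by
    intro g hg q hq
    by_cases hgR : g ∈ R
    · simp only [hΛdef, hgR, if_true, Finset.mem_singleton] at hq
      subst hq
      obtain ⟨hpp, hpK', -, hpd, hpsq, -, -⟩ := hp g hgR
      have hcong : g.eval n₀ ≡ g.eval (w g) [ZMOD (p g : ℤ) ^ 2] :=
        eval_modEq_of_modEq g (hn₀w g hgR)
      have hd : (p g : ℤ) ∣ g.eval n₀ :=
        (dvd_iff_of_modEq hcong (dvd_pow_self _ two_ne_zero)).mpr hpd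
      refine ⟨hpp, lt_of_le_of_lt (le_max_right _ _) hpK', hd,
        fun h => hpsq ((dvd_iff_of_modEq hcong dvd_rfl).mp h), fun g' hg' hne h => ?_⟩
      have := hρ g hg g' hg' (Ne.symm hne) (p g) hpp n₀ hd h
      have := le_max_left ρ K
      omega
    · simp [hΛdef, hgR] at hq
  obtain ⟨N₀, hN₀⟩ := hEi
  obtain ⟨n, hNn, -, hq⟩ := HF n₀ hn₀K Λ hΛ (max N₀ 1)
  obtain ⟨P₀, hP₀, hP₀a, hP₀d⟩ := hN₀ n ((le_max_left _ _).trans hNn)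
  have hPZ : Prime (P₀ : ℤ) := Nat.prime_iff_prime_int.mp hP₀
  obtain ⟨g, hg, hPg⟩ := hPZ.exists_mem_finset_dvd hP₀d
  obtain ⟨q, hqprime, hqN, hge, hqc⟩ := hq g hg
  rw [hge] at hPg
  rcases hPZ.dvd_or_dvd hPg with h | h
  · rcases hPZ.dvd_or_dvd h with h | h
    · exact hBa g hg P₀ hP₀ (Int.natCast_dvd_natCast.mp h) hP₀a
    · by_cases hgR : g ∈ R
      · simp only [hΛdef, hgR, if_true, Finset.prod_singleton] at h
        have := (Nat.prime_dvd_prime_iff_eq hP₀ (hp g hgR).1).mp (Int.natCast_dvd_natCast.mp h)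
        subst this
        exact (hp g hgR).2.2.2.2.2.2 hP₀a
      · simp only [hΛdef, hgR, if_false, Finset.prod_empty] at h
        exact hPZ.not_unit (isUnit_of_dvd_one h)
  · -- `P₀ = q`
    have hqP : q = P₀ := by
      rcases Int.associated_iff.mp ((hPZ.dvd_prime_iff_associated hqprime).mp h) with h1 | h1
      · exact h1.symm
      · have : (0 : ℤ) ≤ P₀ := by positivity
        omega
    subst hqP
    by_cases hgR : g ∈ R
    · simp only [hΛdef, hgR, if_true, Finset.prod_singleton] at hqc
      -- `a p_g ≡ a`, so `p_g ≡ 1`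
      apply (hp g hgR).2.2.2.2.2.1
      have h1 : (P₀ : ℤ) * p g ≡ a * p g [ZMOD m] := hP₀a.mul_right _
      have h2 : a * p g ≡ a [ZMOD m] := (h1.symm.trans hqc).trans (hRc g hgR)
      have h3 := (ZMod.intCast_eq_intCast_iff _ _ _).mpr h2
      push_cast at h3
      have h4 : (a : ZMod m) * ((p g : ℤ) : ZMod m) = (a : ZMod m) * ((1 : ℤ) : ZMod m) := by
        push_cast; rw [mul_one]; exact h3
      exact (ZMod.intCast_eq_intCast_iff _ _ _).mp (ha.mul_left_cancel h4)
    · simp only [hΛdef, hgR, if_false, Finset.prod_empty, mul_one] at hqc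
      exact hgR (Finset.mem_filter.mpr ⟨hg, hqc.symm.trans hP₀a⟩)

/-! #### Stage B: Lemma 3 with `k = 1` — a good prime `≡ a⁻¹`, hence `a² ≡ 1` -/

/-- **Stage B** (Pollack's Lemma 3 with `k = 1`, run inside the controlled family): two large
primes `q₁, q₂ ≡ a` dividing values of `g₀` exactly (supplied by the H-step itself), a CRT base
point where both divide `g₀` exactly, and one more H-step produce a large prime `Q` with
`Q q₁ q₂ ≡ a`, i.e. `Q ≡ a⁻¹ (mod m)`, dividing a value of `g₀` exactly; by Stage A,
`Q ≡ 1` or `Q ≡ a`, whence `a² ≡ 1 (mod m)`. [cite: Pollack2010MurtyH, §3 Lemma 3 and §4] -/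
theorem sq_modEq_one_of_good_primes {s : Finset ℤ[X]} {m : ℕ} {a : ℤ} (ha : IsUnit (a : ZMod m))
    {K : ℕ} (hK : 0 < K) {nstar : ℤ} {B : ℤ[X] → ℕ} {c : ℤ[X] → ℤ}
    (hBK : ∀ g ∈ s, 0 < B g ∧ B g ∣ K)
    {ρ : ℕ} (hρ : ∀ g ∈ s, ∀ g' ∈ s, g ≠ g' → ∀ p : ℕ, p.Prime → ∀ n : ℤ,
      (p : ℤ) ∣ g.eval n → (p : ℤ) ∣ g'.eval n → p ≤ ρ)
    (HF : ∀ n₀ : ℤ, n₀ ≡ nstar [ZMOD K] → ∀ Λ : ℤ[X] → Finset ℕ,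
      (∀ g ∈ s, ∀ q ∈ Λ g, q.Prime ∧ K < q ∧ (q : ℤ) ∣ g.eval n₀ ∧ ¬(q : ℤ) ^ 2 ∣ g.eval n₀ ∧
        ∀ g' ∈ s, g' ≠ g → ¬(q : ℤ) ∣ g'.eval n₀) →
      ∀ N : ℤ, ∃ n : ℤ, N ≤ n ∧ n ≡ nstar [ZMOD K] ∧ ∀ g ∈ s, ∃ q : ℤ, Prime q ∧ N ≤ q ∧
        g.eval n = B g * (∏ p ∈ Λ g, (p : ℤ)) * q ∧ q * (∏ p ∈ Λ g, (p : ℤ)) ≡ c g [ZMOD m])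
    {g₀ : ℤ[X]} (hg₀ : g₀ ∈ s) (hc₀ : c g₀ ≡ a [ZMOD m]) {NA : ℕ}
    (hgood : ∀ q : ℕ, q.Prime → NA ≤ q →
      (∃ n : ℤ, n ≡ nstar [ZMOD K] ∧ (q : ℤ) ∣ g₀.eval n ∧ ¬(q : ℤ) ^ 2 ∣ g₀.eval n) →
      ((q : ℤ) ≡ 1 [ZMOD m] ∨ (q : ℤ) ≡ a [ZMOD m])) :
    a ^ 2 ≡ 1 [ZMOD m] := by
  classical
  have hΛ0 : ∀ n₀ : ℤ, ∀ g ∈ s, ∀ q ∈ (fun _ : ℤ[X] => (∅ : Finset ℕ)) g, q.Prime ∧ K < q ∧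
      (q : ℤ) ∣ g.eval n₀ ∧ ¬(q : ℤ) ^ 2 ∣ g.eval n₀ ∧
      ∀ g' ∈ s, g' ≠ g → ¬(q : ℤ) ∣ g'.eval n₀ := by
    intro n₀ g _ q hq
    simp at hq
  -- two large primes `q₁ < q₂`, both `≡ a`, dividing values of `g₀` exactly once
  obtain ⟨n₁, -, -, hq₁⟩ := HF nstar Int.ModEq.rfl (fun _ => ∅) (hΛ0 nstar) ((max ρ K : ℕ) + 1)
  obtain ⟨q₁, hq₁p, hq₁N, hq₁e, hq₁c⟩ := hq₁ g₀ hg₀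
  simp only [Finset.prod_empty, mul_one] at hq₁e hq₁c
  obtain ⟨n₂, -, -, hq₂⟩ := HF nstar Int.ModEq.rfl (fun _ => ∅) (hΛ0 nstar) (q₁ + 1)
  obtain ⟨q₂, hq₂p, hq₂N, hq₂e, hq₂c⟩ := hq₂ g₀ hg₀
  simp only [Finset.prod_empty, mul_one] at hq₂e hq₂c
  set Q₁ := q₁.toNat with hQ₁def
  set Q₂ := q₂.toNat with hQ₂def
  have hmax : ((max ρ K : ℕ) : ℤ) = max (ρ : ℤ) (K : ℤ) := Nat.cast_max _ _
  have hQ₁ : (Q₁ : ℤ) = q₁ := Int.toNat_of_nonneg (by omega)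
  have hQ₂ : (Q₂ : ℤ) = q₂ := Int.toNat_of_nonneg (by omega)
  have hQ₁p : Q₁.Prime := Nat.prime_iff_prime_int.mpr (by rw [hQ₁]; exact hq₁p)
  have hQ₂p : Q₂.Prime := Nat.prime_iff_prime_int.mpr (by rw [hQ₂]; exact hq₂p)
  have hKQ₁ : K < Q₁ := by
    have := le_max_right (ρ : ℤ) K
    omega
  have hQ₁₂ : Q₁ < Q₂ := by omega
  -- Chinese remainder
  have hcop12 : Nat.Coprime (Q₁ ^ 2) (Q₂ ^ 2) :=
    Nat.Coprime.pow 2 2 ((Nat.coprime_primes hQ₁p hQ₂p).mpr hQ₁₂.ne)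
  obtain ⟨n', hn'1, hn'2⟩ := crt_two (pow_pos hQ₁p.pos 2) (pow_pos hQ₂p.pos 2) hcop12 n₁ n₂
  have hcopK : ∀ Q : ℕ, Q.Prime → K < Q → Nat.Coprime K (Q ^ 2) := fun Q hQ hKQ =>
    Nat.Coprime.pow_right 2 (Nat.coprime_comm.mp ((Nat.Prime.coprime_iff_not_dvd hQ).mpr
      fun h => by have := Nat.le_of_dvd hK h; omega))
  obtain ⟨n₃, hn₃K, hn₃'⟩ := crt_two hK (Nat.mul_pos (pow_pos hQ₁p.pos 2) (pow_pos hQ₂p.pos 2))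
    (Nat.Coprime.mul_right (hcopK Q₁ hQ₁p hKQ₁) (hcopK Q₂ hQ₂p (by omega))) nstar n'
  push_cast at hn₃' hn'1 hn'2
  have hn₃1 : n₃ ≡ n₁ [ZMOD (Q₁ : ℤ) ^ 2] := (Int.ModEq.of_mul_right _ hn₃').trans hn'1
  have hn₃2 : n₃ ≡ n₂ [ZMOD (Q₂ : ℤ) ^ 2] := (Int.ModEq.of_mul_left _ hn₃').trans hn'2
  -- the third H-step, with `Λ g₀ = {Q₁, Q₂}`
  set Λ : ℤ[X] → Finset ℕ := fun g => if g = g₀ then {Q₁, Q₂} else ∅ with hΛdef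
  have key : ∀ (Q : ℕ) (qq nn : ℤ), (Q : ℤ) = qq → Prime qq → ((max ρ K : ℕ) : ℤ) + 1 ≤ qq →
      g₀.eval nn = B g₀ * qq → n₃ ≡ nn [ZMOD (Q : ℤ) ^ 2] →
      Q.Prime ∧ K < Q ∧ (Q : ℤ) ∣ g₀.eval n₃ ∧ ¬(Q : ℤ) ^ 2 ∣ g₀.eval n₃ ∧
        ∀ g' ∈ s, g' ≠ g₀ → ¬(Q : ℤ) ∣ g'.eval n₃ := by
    intro Q qq nn hQ hqq hqqN he hmod
    have hQp : Q.Prime := Nat.prime_iff_prime_int.mpr (by rw [hQ]; exact hqq)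
    have hKQ : K < Q := by
      have := le_max_right (ρ : ℤ) K
      omega
    have hρQ : ρ < Q := by
      have := le_max_left (ρ : ℤ) K
      omega
    have hcong := eval_modEq_of_modEq g₀ hmod
    have hd : (Q : ℤ) ∣ g₀.eval n₃ :=
      (dvd_iff_of_modEq hcong (dvd_pow_self _ two_ne_zero)).mpr
        (by rw [he, ← hQ]; exact Dvd.intro_left _ rfl)
    have hnsq : ¬(Q : ℤ) ^ 2 ∣ g₀.eval n₃ := by
      rw [dvd_iff_of_modEq hcong dvd_rfl, he, ← hQ, sq]
      rintro ⟨x, hx⟩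
      have hQ0 : (Q : ℤ) ≠ 0 := by exact_mod_cast hQp.ne_zero
      have h1 : (Q : ℤ) ∣ B g₀ := ⟨x, mul_right_cancel₀ hQ0 (by linarith [hx])⟩
      have := Nat.le_of_dvd (hBK g₀ hg₀).1 (Int.natCast_dvd_natCast.mp h1)
      have := Nat.le_of_dvd hK (hBK g₀ hg₀).2
      omega
    refine ⟨hQp, hKQ, hd, hnsq, fun g' hg' hne h => ?_⟩
    have := hρ g₀ hg₀ g' hg' (Ne.symm hne) Q hQp n₃ hd h
    omega
  have hΛ : ∀ g ∈ s, ∀ q ∈ Λ g, q.Prime ∧ K < q ∧ (q : ℤ) ∣ g.eval n₃ ∧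
      ¬(q : ℤ) ^ 2 ∣ g.eval n₃ ∧ ∀ g' ∈ s, g' ≠ g → ¬(q : ℤ) ∣ g'.eval n₃ := by
    intro g hg q hq
    by_cases hgg : g = g₀
    · subst hgg
      simp only [hΛdef, if_true, Finset.mem_insert, Finset.mem_singleton] at hq
      rcases hq with rfl | rfl
      · exact key Q₁ q₁ n₁ hQ₁ hq₁p hq₁N hq₁e hn₃1
      · exact key Q₂ q₂ n₂ hQ₂ hq₂p (by omega) hq₂e hn₃2
    · simp [hΛdef, hgg] at hq
  obtain ⟨n₄, -, hn₄K, hq₄⟩ := HF n₃ hn₃K Λ hΛ (max (NA : ℤ) (q₂ + 1))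
  obtain ⟨Q, hQp, hQN, hQe, hQc⟩ := hq₄ g₀ hg₀
  have hprod : (∏ p ∈ Λ g₀, (p : ℤ)) = Q₁ * Q₂ := by
    simp only [hΛdef, if_true]
    rw [Finset.prod_pair hQ₁₂.ne]
  rw [hprod] at hQe hQc
  -- `Q` is a good prime for `g₀`
  set Qn := Q.toNat with hQndef
  have hQn : (Qn : ℤ) = Q := Int.toNat_of_nonneg (by omega)
  have hQnp : Qn.Prime := Nat.prime_iff_prime_int.mpr (by rw [hQn]; exact hQp)
  have hgoodQ := hgood Qn hQnp (by omega) ⟨n₄, hn₄K, by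
      rw [hQn, hQe]; exact Dvd.intro_left _ rfl, by
      rw [hQn, hQe, sq]
      rintro ⟨x, hx⟩
      have hQ0 : Q ≠ 0 := hQp.ne_zero
      have h1 : Q ∣ (B g₀ : ℤ) * (Q₁ * Q₂) := ⟨x, mul_right_cancel₀ hQ0 (by linarith [hx])⟩
      rcases hQp.dvd_or_dvd h1 with h | h
      · have := Int.le_of_dvd (by exact_mod_cast (hBK g₀ hg₀).1) h
        have := Nat.le_of_dvd hK (hBK g₀ hg₀).2
        omega
      · rcases hQp.dvd_or_dvd h with h | h
        · have := Int.le_of_dvd (by omega) h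
          omega
        · have := Int.le_of_dvd (by omega) h
          omega⟩
  rw [hQn] at hgoodQ
  -- the algebra in `ZMod m`
  have e₁ : ((Q₁ : ℤ) : ZMod m) = (a : ZMod m) :=
    (ZMod.intCast_eq_intCast_iff _ _ _).mpr ((hQ₁ ▸ hq₁c).trans hc₀)
  have e₂ : ((Q₂ : ℤ) : ZMod m) = (a : ZMod m) :=
    (ZMod.intCast_eq_intCast_iff _ _ _).mpr ((hQ₂ ▸ hq₂c).trans hc₀)
  have e₃ : (Q : ZMod m) * (a : ZMod m) * (a : ZMod m) = (a : ZMod m) := by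
    have := (ZMod.intCast_eq_intCast_iff _ _ _).mpr (hQc.trans hc₀)
    push_cast at this e₁ e₂
    rw [e₁, e₂] at this
    linear_combination this
  have hsq : (a : ZMod m) * (a : ZMod m) = 1 := by
    rcases hgoodQ with h | h
    · have hQ1 : ((Q : ℤ) : ZMod m) = 1 := by
        have := (ZMod.intCast_eq_intCast_iff _ _ _).mpr h
        simpa using this
      rw [hQ1, one_mul] at e₃
      have ha1 : (a : ZMod m) = 1 := ha.mul_left_cancel (e₃.trans (mul_one _).symm)
      rw [ha1, mul_one]
    · have hQa : ((Q : ℤ) : ZMod m) = a := (ZMod.intCast_eq_intCast_iff _ _ _).mpr h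
      rw [hQa, mul_assoc] at e₃
      exact ha.mul_left_cancel (e₃.trans (mul_one _).symm)
  apply (ZMod.intCast_eq_intCast_iff _ _ _).mp
  push_cast
  rw [sq, hsq]

end Pollack2010

/-! ### Proof of Pollack's Theorem 1 (under Hypothesis H) -/

/-- **Pollack 2010, Theorem 1, PROVED from Schinzel's Hypothesis H**: under Hypothesis H there is
no `E′`-polynomial for `a mod m` unless `a² ≡ 1 (mod m)`. The proof follows the printed one
(§4: Lemma 5's reduction to the distinct irreducible factors, Lemma 6's H-step with prescribed
unitary prime divisors, and the contradiction showing that some factor has only prime divisors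
`≡ 1, a`), with Murty's theorem for that factor replaced by its proof under H (§3, Lemma 3 with
`k = 1`: a prime divisor `≡ a⁻¹` exists, so `a⁻¹ ∈ {1, a}`); fixed prime divisors are absorbed
into the step of the progression instead of being removed by Lemma 2, and exact-division
witnesses are produced by H itself instead of via resultants.
[cite: Pollack2010MurtyH, Theorem 1, §3 Lemma 3, §4 Lemmas 5–6 and proof of Theorem 1] -/
theorem Pollack2010_ePrime_holds : Pollack2010_ePrime := by
  intro hH m a f hm hf
  classical
  have hf0 := hf.ne_zero
  have ha := hf.isUnit_cast hm
  obtain ⟨s, hs, hnorm, hF⟩ := Pollack2010.reduce_squarefree hf hf0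
  obtain ⟨K, nstar, L₀, B, c, hK, hL₀, hfix, hKL₀, hB⟩ := Pollack2010.exists_family hs hm
  -- `L₀` contains no prime `≡ a`
  have hL₀a : ∀ ℓ ∈ L₀, ¬(ℓ : ℤ) ≡ a [ZMOD m] := by
    intro ℓ hℓ hℓa
    obtain ⟨hℓp, hℓm | hℓfix⟩ := hL₀ ℓ hℓ
    · have h1 : ((ℓ : ℤ) : ZMod m) = (a : ZMod m) := (ZMod.intCast_eq_intCast_iff _ _ _).mpr hℓa
      push_cast at h1
      exact (ZMod.isUnit_prime_iff_not_dvd hℓp).mp (h1 ▸ ha) hℓm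
    · obtain ⟨n, hn⟩ := hF.2 ℓ hℓp hℓa
      exact hn (by rw [eval_prod]; exact hℓfix n)
  have hBa : ∀ g ∈ s, ∀ p : ℕ, p.Prime → p ∣ B g → ¬(p : ℤ) ≡ a [ZMOD m] :=
    fun g hg p hp hpB => hL₀a p ((hB g hg).2.2.2.1 p hp hpB)
  -- a uniform Bezout bound over the pairs of distinct factors
  have hρ' : ∀ gg : ℤ[X] × ℤ[X], ∃ ρ : ℕ, gg.1 ∈ s → gg.2 ∈ s → gg.1 ≠ gg.2 → ∀ p : ℕ, p.Prime →
      ∀ n : ℤ, (p : ℤ) ∣ gg.1.eval n → (p : ℤ) ∣ gg.2.eval n → p ≤ ρ := by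
    rintro ⟨g, g'⟩
    by_cases h : g ∈ s ∧ g' ∈ s ∧ g ≠ g'
    · obtain ⟨ρ, hρ⟩ := Pollack2010.exists_bound_common_prime (hs g h.1).1 (hs g' h.2.1).1
        (hs g h.1).2.1 (fun hass => h.2.2 (hnorm g h.1 g' h.2.1 hass))
      exact ⟨ρ, fun _ _ _ => hρ⟩
    · exact ⟨0, fun h1 h2 h3 => absurd ⟨h1, h2, h3⟩ h⟩
  choose ρf hρf using hρ'
  set ρ := ∑ gg ∈ s ×ˢ s, ρf gg with hρdef
  have hρ : ∀ g ∈ s, ∀ g' ∈ s, g ≠ g' → ∀ p : ℕ, p.Prime → ∀ n : ℤ,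
      (p : ℤ) ∣ g.eval n → (p : ℤ) ∣ g'.eval n → p ≤ ρ := by
    intro g hg g' hg' hne p hp n h1 h2
    exact (hρf (g, g') hg hg' hne p hp n h1 h2).trans
      (Finset.single_le_sum (fun _ _ => Nat.zero_le _) (Finset.mem_product.mpr ⟨hg, hg'⟩))
  -- the H-step along the family
  have HF : ∀ n₀ : ℤ, n₀ ≡ nstar [ZMOD K] → ∀ Λ : ℤ[X] → Finset ℕ,
      (∀ g ∈ s, ∀ q ∈ Λ g, q.Prime ∧ K < q ∧ (q : ℤ) ∣ g.eval n₀ ∧ ¬(q : ℤ) ^ 2 ∣ g.eval n₀ ∧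
        ∀ g' ∈ s, g' ≠ g → ¬(q : ℤ) ∣ g'.eval n₀) →
      ∀ N : ℤ, ∃ n : ℤ, N ≤ n ∧ n ≡ nstar [ZMOD K] ∧ ∀ g ∈ s, ∃ q : ℤ, Prime q ∧ N ≤ q ∧
        g.eval n = B g * (∏ p ∈ Λ g, (p : ℤ)) * q ∧
          q * (∏ p ∈ Λ g, (p : ℤ)) ≡ c g [ZMOD m] :=
    fun n₀ hn₀ Λ hΛ N =>
      Pollack2010.exists_prime_cofactors_in_family hH hs hK (fun ℓ hℓ => (hL₀ ℓ hℓ).1) hfix hKL₀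
        hB hn₀ hΛ N
  -- condition (i) for `∏ g`, along the integers
  have hEi : ∃ N₀ : ℤ, ∀ n : ℤ, N₀ ≤ n → ∃ p : ℕ, p.Prime ∧ (p : ℤ) ≡ a [ZMOD m] ∧
      (p : ℤ) ∣ ∏ g ∈ s, g.eval n := by
    obtain ⟨N, hN⟩ := Filter.eventually_atTop.mp hF.1
    refine ⟨N, fun n hn => ?_⟩
    obtain ⟨p, hp, hpa, hpd⟩ := hN n.toNat (by omega)
    refine ⟨p, hp, hpa, ?_⟩
    rw [Int.toNat_of_nonneg (by omega), eval_prod] at hpd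
    exact hpd
  obtain ⟨g₀, hg₀, hc₀, NA, hgood⟩ := Pollack2010.exists_factor_with_good_primes ha hK hBa hρ HF hEi
  exact Pollack2010.sq_modEq_one_of_good_primes ha hK
    (fun g hg => ⟨(hB g hg).1, dvd_of_mul_left_dvd (hB g hg).2.2.2.2.2⟩) hρ HF hg₀ hc₀ hgood

end Literature.Barriers.Parity
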